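import Mathlib
import Summits.MatrixMultiplication.MatrixMultiplication.Theorems.SoloBlindLThreeSets

/-!
# Squarefree `H(3)`: an `H`-good zero-sum-free set has at most three 3-subsets of a given sum (solo-blind, s79)

For zero-sum-free SETS `S` in an abelian group of exponent 3 the sharp bound on the number of 3-subsets
with a common sum `τ` is `6` (`soloBlind_rep3_card_le_six`).  Under the `H`-hypothesis — no subset of `S`
sums to `-τ` — the sharp bound drops to `3 = 2² - 1`:
* `soloBlind_rep3_meet_of_hgood` — two members must meet (two disjoint members have total `2τ = -τ`);
* `soloBlind_rep3_card_le_three_of_hgood` — hence four members would meet pairwise, which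
  `soloBlind_rep3_no_four_meeting` (no Pasch configuration) forbids;
* `soloBlind_rep3_hgood_three_attained` — a zero-sum-free, `H`-good 6-set in `𝔽₃⁴` with three members.
Two such blocks amalgamate (file `SoloBlindAmalgam`) to the extremal squarefree value `6 = 2 · 3`.
-/

namespace Summit.MatrixMultiplication.MatrixMultiplication.Theorems

open Finset

section Main
variable {G : Type*} [AddCommGroup G] [DecidableEq G] {S : Finset G} {τ : G}

/-- Under the `H`-hypothesis two distinct members of `soloBlindRep3 S τ` meet. -/
theorem soloBlind_rep3_meet_of_hgood (h3 : ∀ y : G, y + y + y = 0)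
    (hg : ∀ T ⊆ S, ∑ x ∈ T, x ≠ -τ) {A B : Finset G}
    (hA : A ∈ soloBlindRep3 S τ) (hB : B ∈ soloBlindRep3 S τ) : (A ∩ B).Nonempty := by
  by_contra hm
  rw [Finset.not_nonempty_iff_eq_empty] at hm
  have hd : Disjoint A B := Finset.disjoint_iff_inter_eq_empty.mpr hm
  rw [soloBlind_mem_rep3] at hA hB
  have hsub : A ∪ B ⊆ S := Finset.union_subset hA.1 hB.1
  have hsum : ∑ x ∈ A ∪ B, x = -τ := by
    rw [Finset.sum_union hd, hA.2.2, hB.2.2]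
    have := h3 τ
    rw [← add_eq_zero_iff_eq_neg]; exact this
  exact hg _ hsub hsum

/-- SQUAREFREE `H(3)`: an `H`-good zero-sum-free set in an abelian group of exponent 3 has at most three
3-subsets with sum `τ`. -/
theorem soloBlind_rep3_card_le_three_of_hgood (zsf : ∀ T ⊆ S, ∑ x ∈ T, x = 0 → T = ∅)
    (h3 : ∀ y : G, y + y + y = 0) (hg : ∀ T ⊆ S, ∑ x ∈ T, x ≠ -τ) :
    (soloBlindRep3 S τ).card ≤ 3 := by
  by_contra hlt
  rw [not_le] at hlt
  obtain ⟨U, hU, cU⟩ := Finset.exists_subset_card_eq (show 4 ≤ (soloBlindRep3 S τ).card by omega)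
  have hne : U.Nonempty := by rw [← Finset.card_pos, cU]; norm_num
  obtain ⟨A, hAU⟩ := hne
  have c3 : (U.erase A).card = 3 := by rw [Finset.card_erase_of_mem hAU, cU]
  obtain ⟨B, C, D, hBC, hBD, hCD, hE⟩ := Finset.card_eq_three.mp c3
  have hBU : B ∈ U.erase A := by rw [hE]; simp
  have hCU : C ∈ U.erase A := by rw [hE]; simp
  have hDU : D ∈ U.erase A := by rw [hE]; simp
  have hAB : A ≠ B := (Finset.ne_of_mem_erase hBU).symm
  have hAC : A ≠ C := (Finset.ne_of_mem_erase hCU).symm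
  have hAD : A ≠ D := (Finset.ne_of_mem_erase hDU).symm
  have mA := hU hAU
  have mB := hU (Finset.mem_of_mem_erase hBU)
  have mC := hU (Finset.mem_of_mem_erase hCU)
  have mD := hU (Finset.mem_of_mem_erase hDU)
  have meet := fun {P Q : Finset G} (hP : P ∈ soloBlindRep3 S τ) (hQ : Q ∈ soloBlindRep3 S τ) =>
    soloBlind_rep3_meet_of_hgood h3 hg hP hQ
  exact soloBlind_rep3_no_four_meeting zsf h3 mA mB mC mD hAB hAC hAD hBC hBD hCD
    (meet mA mB) (meet mA mC) (meet mA mD) (meet mB mC) (meet mB mD) (meet mC mD)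

/-- The same for `ZMod 3`-modules. -/
theorem soloBlind_rep3_card_le_three_of_hgood_module {V : Type*} [AddCommGroup V] [Module (ZMod 3) V]
    [DecidableEq V] {S : Finset V} (zsf : ∀ T ⊆ S, ∑ x ∈ T, x = 0 → T = ∅) {τ : V}
    (hg : ∀ T ⊆ S, ∑ x ∈ T, x ≠ -τ) : (soloBlindRep3 S τ).card ≤ 3 :=
  soloBlind_rep3_card_le_three_of_hgood zsf (fun y => soloBlind_three_torsion y) hg

end Main

/-! ### Sharpness: three is attained by an `H`-good zero-sum-free 6-set in `𝔽₃⁴` -/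

/-- `𝔽₃⁴` as a nested product. -/
abbrev SoloBlindH3G4 : Type := ZMod 3 × ZMod 3 × ZMod 3 × ZMod 3

/-- Six vectors: the universal realisation of the 'triangle' class `{1,2,3},{1,4,5},{2,4,6}`. -/
def soloBlindH3_h : Fin 6 → SoloBlindH3G4 :=
  ![(2, 1, 0, 1), (2, 1, 1, 0), (1, 0, 0, 0), (0, 1, 0, 0), (0, 0, 1, 0), (0, 0, 0, 1)]

/-- The target. -/
def soloBlindH3_tau : SoloBlindH3G4 := (2, 2, 1, 1)

/-- The six vectors are distinct. -/
theorem soloBlindH3_injective : Function.Injective soloBlindH3_h := by decide +kernel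

/-- Zero-sum free (all `2^6` index subsets). -/
theorem soloBlindH3_zsf : ∀ T : Finset (Fin 6), ∑ i ∈ T, soloBlindH3_h i = 0 → T = ∅ := by
  decide +kernel

/-- `H`-good: no index subset sums to `-τ`. -/
theorem soloBlindH3_hgood : ∀ T : Finset (Fin 6), ∑ i ∈ T, soloBlindH3_h i ≠ -soloBlindH3_tau := by
  decide +kernel

/-- Exactly three index 3-subsets have sum `τ`. -/
theorem soloBlindH3_three : (((univ : Finset (Fin 6)).powersetCard 3).filter
    (fun T => ∑ i ∈ T, soloBlindH3_h i = soloBlindH3_tau)).card = 3 := by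
  decide +kernel

/-- SHARPNESS of squarefree `H(3)`: the image set is zero-sum free, `H`-good, and has exactly three
3-subsets of sum `τ`. -/
theorem soloBlind_rep3_hgood_three_attained :
    (∀ T ⊆ (univ : Finset (Fin 6)).map ⟨soloBlindH3_h, soloBlindH3_injective⟩,
      ∑ x ∈ T, x = 0 → T = ∅) ∧
    (∀ T ⊆ (univ : Finset (Fin 6)).map ⟨soloBlindH3_h, soloBlindH3_injective⟩,
      ∑ x ∈ T, x ≠ -soloBlindH3_tau) ∧
    (soloBlindRep3 ((univ : Finset (Fin 6)).map ⟨soloBlindH3_h, soloBlindH3_injective⟩)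
      soloBlindH3_tau).card = 3 := by
  have pull : ∀ T ⊆ (univ : Finset (Fin 6)).map ⟨soloBlindH3_h, soloBlindH3_injective⟩,
      ∃ U : Finset (Fin 6), U.map ⟨soloBlindH3_h, soloBlindH3_injective⟩ = T := by
    intro T hT
    refine ⟨univ.filter (fun i => soloBlindH3_h i ∈ T), ?_⟩
    ext x
    simp only [mem_map, mem_filter, mem_univ, true_and, Function.Embedding.coeFn_mk]
    constructor
    · rintro ⟨i, hi, rfl⟩; exact hi
    · intro hx
      have := hT hx
      rw [mem_map] at this
      obtain ⟨i, -, rfl⟩ := this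
      exact ⟨i, hx, rfl⟩
  refine ⟨?_, ?_, ?_⟩
  · intro T hT hsum
    obtain ⟨U, rfl⟩ := pull T hT
    rw [sum_map] at hsum
    have := soloBlindH3_zsf U hsum
    rw [this]; rfl
  · intro T hT
    obtain ⟨U, rfl⟩ := pull T hT
    rw [sum_map]
    exact soloBlindH3_hgood U
  · rw [soloBlind_rep3_card_map soloBlindH3_h soloBlindH3_injective, soloBlindH3_three]

end Summit.MatrixMultiplication.MatrixMultiplication.Theorems
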